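import Summits.CriticalPhenomena.PercolationContinuityZ3.Theorems.PercNearOneGluingNoHeavyQuantIndepBlobGapCalculus
import HarnessLib

/-!
# QUANT lane R8, T-DIB: the restricted tail `TL_U` of a sub-cloud is the ordinary tail of the product-Bernoulli law on the subtype `↥U`

builds on p205010 (kernel theorem, internal audit signed; external expert review pending)

Support file (`--supports stmt-CriticalPhenomena-4575`), QUANT lane seat prim-quant-p1 (gen 12); memo
`run/shared/lean/prim/quant/P1-SURPLUS.md` §23.11–23.12.  Theorems only; no definitions, no sorries, standard axioms.

The device programme for the remaining chord cells of Conjecture J′ needs rows that the lane proved for WHOLE systems (`univ` sums: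
Cantelli `tail_ge_gate_of_cantelli`, the moment identities of `…IndepBlobMoments`, the far rows) applied to a SUB-CLOUD `U ⊆ κ`, whose law
the chord certificate writes as the restricted tail `TL_U(t) = Σ_{s ⊆ U} (Π_{i∈U} …)·𝟙[t ≤ Σ_{i∈s} a_i]` (`…GapCalculus`).
* `Quant.IndepBlob.sum_powerset_eq_sum_subtype` — reindexing `U.powerset ≃ Finset ↥U`.
* `Quant.IndepBlob.tailU_eq_subtype` — `TL_U(t)` equals the product-form tail of the system `(p ∘ val, a ∘ val)` on `↥U`;
* `Quant.IndepBlob.tailU_eq_subtype_filter` — the same in the filter form used by the kernel rows.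
So every `univ`-row applies verbatim to a sub-cloud. [cite: KozmaNitzan2024, Conjecture 3 (p. 15)] (the gluing rows served); [this work].
-/

namespace Summit.CriticalPhenomena.PercolationContinuityZ3.Theorems

namespace Quant

namespace IndepBlob

open Finset

variable {κ : Type*} [DecidableEq κ]

/-- Reindexing a sum over `U.powerset` as a sum over `Finset ↥U`. [this work] -/
theorem sum_powerset_eq_sum_subtype (U : Finset κ) (f : Finset κ → ℝ) :
    ∑ s ∈ U.powerset, f s = ∑ W : Finset ↥U, f (W.map (Function.Embedding.subtype _)) := by
  refine Finset.sum_bij' (fun s _ => s.subtype (· ∈ U)) (fun W _ => W.map (Function.Embedding.subtype _)) ?_ ?_ ?_ ?_ ?_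
  · intro s _; exact Finset.mem_univ _
  · intro W _; rw [Finset.mem_powerset]; intro i hi; rw [Finset.mem_map] at hi
    obtain ⟨j, _, rfl⟩ := hi; exact j.2
  · intro s hs
    rw [Finset.subtype_map]
    exact Finset.filter_true_of_mem fun i hi => Finset.mem_powerset.1 hs hi
  · intro W _
    ext i
    simp [Finset.mem_subtype]
  · intro s hs
    congr 1
    rw [Finset.subtype_map]
    exact (Finset.filter_true_of_mem fun i hi => Finset.mem_powerset.1 hs hi).symm

/-- **`TL_U` is the tail of the product law on the subtype.** [this work] -/
theorem tailU_eq_subtype (p : κ → ℝ) (a : κ → ℕ) (U : Finset κ) (t : ℕ) :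
    ∑ s ∈ U.powerset, (∏ i ∈ U, (if i ∈ s then p i else 1 - p i)) * (if t ≤ ∑ i ∈ s, a i then (1 : ℝ) else 0) =
      ∑ W : Finset ↥U, (∏ i : ↥U, (if i ∈ W then p i.1 else 1 - p i.1)) *
        (if t ≤ ∑ i ∈ W, a i.1 then (1 : ℝ) else 0) := by
  rw [sum_powerset_eq_sum_subtype U]
  refine Finset.sum_congr rfl fun W _ => ?_
  have hmem : ∀ i : ↥U, (i.1 ∈ W.map (Function.Embedding.subtype _)) ↔ i ∈ W := by
    intro i
    constructor
    · intro h
      rw [Finset.mem_map] at h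
      obtain ⟨j, hj, hji⟩ := h
      have : j = i := Subtype.ext hji
      rw [← this]; exact hj
    · intro h
      exact Finset.mem_map.2 ⟨i, h, rfl⟩
  have hprod : ∏ i ∈ U, (if i ∈ W.map (Function.Embedding.subtype _) then p i else 1 - p i) =
      ∏ i : ↥U, (if i ∈ W then p i.1 else 1 - p i.1) := by
    rw [← Finset.prod_coe_sort U]
    refine Finset.prod_congr rfl fun i _ => ?_
    by_cases h : i ∈ W
    · rw [if_pos ((hmem i).2 h), if_pos h]
    · rw [if_neg (fun h' => h ((hmem i).1 h')), if_neg h]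
  have hsum : ∑ i ∈ W.map (Function.Embedding.subtype _), a i = ∑ i ∈ W, a i.1 := by
    rw [Finset.sum_map]; rfl
  rw [hprod, hsum]

/-- The same bridge in the filter form of the kernel rows:
`TL_U(t) = Σ_{W : Finset ↥U, t ≤ Σ_{i∈W} a_i} Π_{i : ↥U} (…)`. [this work] -/
theorem tailU_eq_subtype_filter (p : κ → ℝ) (a : κ → ℕ) (U : Finset κ) (t : ℕ) :
    ∑ s ∈ U.powerset, (∏ i ∈ U, (if i ∈ s then p i else 1 - p i)) * (if t ≤ ∑ i ∈ s, a i then (1 : ℝ) else 0) =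
      ∑ W ∈ (Finset.univ : Finset (Finset ↥U)).filter (fun W => t ≤ ∑ i ∈ W, a i.1),
        (∏ i : ↥U, (if i ∈ W then p i.1 else 1 - p i.1)) := by
  rw [tailU_eq_subtype, Finset.sum_filter]
  refine Finset.sum_congr rfl fun W _ => ?_
  split_ifs <;> simp

end IndepBlob

end Quant

end Summit.CriticalPhenomena.PercolationContinuityZ3.Theorems
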